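import Summits.AtomisticToContinuum.Crystallization.Theses.IsometryAtoms
import Summits.AtomisticToContinuum.Crystallization.Theorems.PalmUnimodularRigidityBenjaminiSchrammLimitEmbedding
import Summits.AtomisticToContinuum.Crystallization.Theorems.LayeredLawsSelectHcp.Negative.FccModel
import Mathlib.MeasureTheory.Constructions.Polish.Basic

/-!
# Negative knowledge for crux `MinimisingLawsHaveAtoms` (stmt-AtomisticToContinuum-15776), II:
# laws of one-parameter families of configurations — probability, hard core, Mecke identity and
# ISOMETRY-DIFFUSENESS, parameter-wise

Standing crux disprover `cdisprove-stmt-AtomisticToContinuum-15776`,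
`--supports stmt-AtomisticToContinuum-15776` (definition-free restatement of the machine, so that it
lands by kernel review; the `def`-based version `DiffuseFamilies.lean` is review-queued).

A counterexample to `IsometryAtoms.MinimisingLawsHaveAtoms` must be a law on `Measure ℝ³` charging
NO rooted isometry class `{count|A(Y − q)}` — a law without atoms, i.e. a continuum mixture of
pairwise non-isometric configurations.  The machine producing such laws, for a one-parameter family
of carriers `C : ℝ → Set ℝ³` such that `t ↦ count|C t` is a MEASURABLE EMBEDDING into the Giry
σ-algebra, pushed forward from a parameter law `ν` on `ℝ`:
* `measurableEmbedding_count_restrict_of_continuous` — the embedding property from a CONTINUOUS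
  INJECTIVE family `ℝ → RootedHardCoreConfig ℝ³ δ` in the local rubber metric (Lusin–Souslin
  `Continuous.measurableEmbedding` composed with the landed `BenjaminiSchrammLimit.measurableEmbedding_toMeasure`);
* `ae_isRootedHardCore_map_family`, `integral_map_family` — a.s. properties and Bochner integrals
  are read parameter-wise;
* `isPointStationaryLaw_map_family` — the push-forward is point-stationary as soon as every member
  `count|C t` satisfies the Mecke identity pointwise (no Giry-measurability of inner integrals needed);
* `map_family_rootedClass_eq_zero` — it charges NO rooted isometry class as soon as `ν` has no
  atoms and an isometry invariant separates the carriers;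
* `mecke_count_restrict_addSubgroup` — counting measures of countable additive subgroups of `ℝ³`
  satisfy the Mecke identity pointwise, for every test function.
Instances: `RandomSpacingChain.lean` (minimising hypothesis and normalisation load-bearing).
All `[folklore]`.
-/

noncomputable section

namespace Summit.AtomisticToContinuum.Crystallization.Theorems.MinimisingLawsHaveAtoms.Negative.DiffuseFamilyLaws

open MeasureTheory Set Filter Metric Function
open scoped ENNReal Topology
open Literature.MathematicalPhysics.StatisticalMechanics Literature.Probability.Process
open Literature.Probability.Process.LocalConfig
open Summit.AtomisticToContinuum.Crystallization.Theorems.BenjaminiSchrammLimit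
  (measurableEmbedding_toMeasure)
open Summit.AtomisticToContinuum.Crystallization.Theorems.LayeredLawsSelectHcp.Negative.DiracLaws
  (map_count_restrict_eq)
open Summit.AtomisticToContinuum.Crystallization.Theorems.LayeredLawsSelectHcp.Negative.FccModel
  (set_eq_of_count_restrict_eq)

/-! ## §0 Rooted isometry classes consist of isometric images -/

/-- The pattern map `s ↦ A (s − q)` is an isometry of `ℝ³`. [folklore] -/
theorem isometry_pattern (A : EuclideanSpace ℝ (Fin 3) →ₗᵢ[ℝ] EuclideanSpace ℝ (Fin 3))
    (q : EuclideanSpace ℝ (Fin 3)) : Isometry fun s : EuclideanSpace ℝ (Fin 3) => A (s - q) :=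
  Isometry.of_dist_eq fun x y => by rw [A.dist_map, dist_sub_right]

/-- A counting measure in the rooted isometry class of `Y` has an isometric image of `Y` as
carrier. [folklore] -/
theorem exists_eq_image_of_mem_rootedClass {Y S : Set (EuclideanSpace ℝ (Fin 3))}
    (h : (Measure.count : Measure (EuclideanSpace ℝ (Fin 3))).restrict S ∈
      {μ : Measure (EuclideanSpace ℝ (Fin 3)) |
        ∃ A : EuclideanSpace ℝ (Fin 3) →ₗᵢ[ℝ] EuclideanSpace ℝ (Fin 3), ∃ q ∈ Y,
          μ = (Measure.count : Measure (EuclideanSpace ℝ (Fin 3))).restrict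
            ((fun s => A (s - q)) '' Y)}) :
    ∃ φ : EuclideanSpace ℝ (Fin 3) → EuclideanSpace ℝ (Fin 3), Isometry φ ∧ S = φ '' Y := by
  obtain ⟨A, q, -, hS⟩ := h
  exact ⟨fun s => A (s - q), isometry_pattern A q, set_eq_of_count_restrict_eq hS⟩

/-! ## §1 One-parameter families whose counting measures form a measurable embedding -/

section Bridge

variable {δ : ℝ} [Fact (0 < δ)]

/-- **The embedding from a continuous injective family of rooted hard-core configurations**: for
`f : ℝ → RootedHardCoreConfig ℝ³ δ` continuous (local rubber metric) and injective, `t ↦ count|f t`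
is a measurable embedding of `ℝ` into `Measure ℝ³` (Lusin–Souslin on the compact metric target,
then the landed embedding `S ↦ count|S`). [folklore] -/
theorem measurableEmbedding_count_restrict_of_continuous
    (f : ℝ → RootedHardCoreConfig (EuclideanSpace ℝ (Fin 3)) δ) (hf : Continuous f)
    (hinj : Injective f) :
    MeasurableEmbedding fun t => (Measure.count : Measure (EuclideanSpace ℝ (Fin 3))).restrict
      (((f t).1 : LocalConfig (EuclideanSpace ℝ (Fin 3))) : Set (EuclideanSpace ℝ (Fin 3))) :=
  (measurableEmbedding_toMeasure (EuclideanSpace ℝ (Fin 3)) (δ := δ)).comp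
    (hf.measurableEmbedding hinj)

end Bridge

section Family

variable {C : ℝ → Set (EuclideanSpace ℝ (Fin 3))} {ν : Measure ℝ}

/-- A.s. properties of the push-forward law are read member-wise: if every `count|C t` is a rooted
`δ`-hard-core configuration, the law is a.s. `δ`-hard-core. [folklore] -/
theorem ae_isRootedHardCore_map_family
    (hC : MeasurableEmbedding fun t =>
      (Measure.count : Measure (EuclideanSpace ℝ (Fin 3))).restrict (C t))
    {δ : ℝ} (hhc : ∀ t, IsRootedHardCore δ
      ((Measure.count : Measure (EuclideanSpace ℝ (Fin 3))).restrict (C t))) :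
    ∀ᵐ μ ∂(ν.map fun t => (Measure.count : Measure (EuclideanSpace ℝ (Fin 3))).restrict (C t)),
      IsRootedHardCore δ μ :=
  hC.ae_map_iff.2 (Eventually.of_forall hhc)

/-- Bochner integrals against the push-forward law are parameter integrals (no measurability of the
integrand needed). [folklore] -/
theorem integral_map_family
    (hC : MeasurableEmbedding fun t =>
      (Measure.count : Measure (EuclideanSpace ℝ (Fin 3))).restrict (C t))
    (F : Measure (EuclideanSpace ℝ (Fin 3)) → ℝ) :
    ∫ μ, F μ ∂(ν.map fun t => (Measure.count : Measure (EuclideanSpace ℝ (Fin 3))).restrict (C t)) =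
      ∫ t, F ((Measure.count : Measure (EuclideanSpace ℝ (Fin 3))).restrict (C t)) ∂ν :=
  hC.integral_map F

/-- Outer measures under the push-forward law are parameter-wise. [folklore] -/
theorem map_family_apply
    (hC : MeasurableEmbedding fun t =>
      (Measure.count : Measure (EuclideanSpace ℝ (Fin 3))).restrict (C t))
    (s : Set (Measure (EuclideanSpace ℝ (Fin 3)))) :
    (ν.map fun t => (Measure.count : Measure (EuclideanSpace ℝ (Fin 3))).restrict (C t)) s =
      ν ((fun t => (Measure.count : Measure (EuclideanSpace ℝ (Fin 3))).restrict (C t)) ⁻¹' s) :=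
  hC.map_apply _ s

/-- **Point-stationarity from the pointwise Mecke identity**: if every member `count|C t` satisfies
the Mecke identity for every test function, the push-forward law is point-stationary. [folklore] -/
theorem isPointStationaryLaw_map_family
    (hC : MeasurableEmbedding fun t =>
      (Measure.count : Measure (EuclideanSpace ℝ (Fin 3))).restrict (C t))
    (hMecke : ∀ t, ∀ g : Measure (EuclideanSpace ℝ (Fin 3)) → EuclideanSpace ℝ (Fin 3) → ℝ≥0∞,
      ∫⁻ y, g ((Measure.count : Measure (EuclideanSpace ℝ (Fin 3))).restrict (C t)) y
          ∂((Measure.count : Measure (EuclideanSpace ℝ (Fin 3))).restrict (C t)) =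
        ∫⁻ y, g (((Measure.count : Measure (EuclideanSpace ℝ (Fin 3))).restrict (C t)).map
            fun z => z - y) (-y)
          ∂((Measure.count : Measure (EuclideanSpace ℝ (Fin 3))).restrict (C t))) :
    IsPointStationaryLaw
      (ν.map fun t => (Measure.count : Measure (EuclideanSpace ℝ (Fin 3))).restrict (C t)) := by
  intro g _
  rw [hC.lintegral_map, hC.lintegral_map]
  exact lintegral_congr fun t => hMecke t g

/-- **Isometry-diffuseness from a separating invariant**: if `ν` has no atoms and an isometry
invariant `ι` of point sets takes pairwise different values on the carriers `C t`, the
push-forward law charges NO rooted isometry class (at most one parameter produces an isometric copy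
of a given `Y`). [folklore] -/
theorem map_family_rootedClass_eq_zero [NullSingletonClass ν]
    (hC : MeasurableEmbedding fun t =>
      (Measure.count : Measure (EuclideanSpace ℝ (Fin 3))).restrict (C t))
    {β : Type*} (ι : Set (EuclideanSpace ℝ (Fin 3)) → β)
    (hι : ∀ φ : EuclideanSpace ℝ (Fin 3) → EuclideanSpace ℝ (Fin 3), Isometry φ →
      ∀ X : Set (EuclideanSpace ℝ (Fin 3)), ι (φ '' X) = ι X)
    (hsep : Injective fun t => ι (C t)) (Y : Set (EuclideanSpace ℝ (Fin 3))) :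
    (ν.map fun t => (Measure.count : Measure (EuclideanSpace ℝ (Fin 3))).restrict (C t))
      {μ : Measure (EuclideanSpace ℝ (Fin 3)) |
        ∃ A : EuclideanSpace ℝ (Fin 3) →ₗᵢ[ℝ] EuclideanSpace ℝ (Fin 3), ∃ q ∈ Y,
          μ = (Measure.count : Measure (EuclideanSpace ℝ (Fin 3))).restrict
            ((fun s => A (s - q)) '' Y)} = 0 := by
  rw [map_family_apply hC]
  refine Set.Subsingleton.measure_zero ?_ _
  intro t₁ ht₁ t₂ ht₂
  apply hsep
  obtain ⟨φ₁, hφ₁, e₁⟩ := exists_eq_image_of_mem_rootedClass ht₁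
  obtain ⟨φ₂, hφ₂, e₂⟩ := exists_eq_image_of_mem_rootedClass ht₂
  change ι (C t₁) = ι (C t₂)
  rw [e₁, e₂, hι _ hφ₁, hι _ hφ₂]

end Family

/-! ## §2 The Mecke identity holds pointwise at counting measures of additive subgroups -/

/-- **Counting measures of countable additive subgroups satisfy the Mecke identity pointwise**, for
every test function: `θ_y count|L = count|L` for `y ∈ L` and `count|L` is invariant under `y ↦ −y`
(the computation of `DiracLaws.pointStationary_dirac_addSubgroup`, freed from the Dirac law).
[folklore] -/
theorem mecke_count_restrict_addSubgroup (L : AddSubgroup (EuclideanSpace ℝ (Fin 3)))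
    (hL : (L : Set (EuclideanSpace ℝ (Fin 3))).Countable)
    (g : Measure (EuclideanSpace ℝ (Fin 3)) → EuclideanSpace ℝ (Fin 3) → ℝ≥0∞) :
    ∫⁻ y, g ((Measure.count : Measure (EuclideanSpace ℝ (Fin 3))).restrict
        (L : Set (EuclideanSpace ℝ (Fin 3)))) y
        ∂((Measure.count : Measure (EuclideanSpace ℝ (Fin 3))).restrict
          (L : Set (EuclideanSpace ℝ (Fin 3)))) =
      ∫⁻ y, g (((Measure.count : Measure (EuclideanSpace ℝ (Fin 3))).restrict
          (L : Set (EuclideanSpace ℝ (Fin 3)))).map fun z => z - y) (-y)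
        ∂((Measure.count : Measure (EuclideanSpace ℝ (Fin 3))).restrict
          (L : Set (EuclideanSpace ℝ (Fin 3)))) := by
  set ν := (Measure.count : Measure (EuclideanSpace ℝ (Fin 3))).restrict
    (L : Set (EuclideanSpace ℝ (Fin 3))) with hνdef
  have hLm : MeasurableSet (L : Set (EuclideanSpace ℝ (Fin 3))) := hL.measurableSet
  have h1 : ∀ y ∈ (L : Set (EuclideanSpace ℝ (Fin 3))), Measure.map (fun z => z - y) ν = ν :=
      fun y hy => by
    have : (fun z : EuclideanSpace ℝ (Fin 3) => z - y) = ⇑(MeasurableEquiv.subRight y) := rfl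
    rw [this]
    refine map_count_restrict_eq _ hL ?_
    ext z
    simp only [Set.mem_preimage, SetLike.mem_coe]
    change z - y ∈ L ↔ z ∈ L
    exact ⟨fun h => by simpa using L.add_mem h hy, fun h => L.sub_mem h hy⟩
  have h2 : (fun y => g (Measure.map (fun z => z - y) ν) (-y)) =ᵐ[ν] fun y => g ν (-y) := by
    filter_upwards [ae_restrict_mem hLm] with y hy
    rw [h1 y hy]
  rw [lintegral_congr_ae h2]
  have h3 : Measure.map (MeasurableEquiv.neg (EuclideanSpace ℝ (Fin 3))) ν = ν := by
    refine map_count_restrict_eq _ hL ?_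
    ext z
    simp only [Set.mem_preimage, SetLike.mem_coe]
    change -z ∈ L ↔ z ∈ L
    exact neg_mem_iff
  calc ∫⁻ y, g ν y ∂ν
      = ∫⁻ y, g ν y ∂(Measure.map (MeasurableEquiv.neg (EuclideanSpace ℝ (Fin 3))) ν) := by rw [h3]
    _ = ∫⁻ y, g ν ((MeasurableEquiv.neg (EuclideanSpace ℝ (Fin 3))) y) ∂ν := lintegral_map_equiv _ _
    _ = ∫⁻ y, g ν (-y) ∂ν := rfl

end Summit.AtomisticToContinuum.Crystallization.Theorems.MinimisingLawsHaveAtoms.Negative.DiffuseFamilyLaws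

end
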